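import Summits.CriticalPhenomena.PercolationContinuityZ3.Theorems.PercNearOneGluingNoHeavyLowerTailSahiCombTriangleBridge
import Summits.CriticalPhenomena.PercolationContinuityZ3.Theorems.PercNearOneGluingNoHeavyLowerTailSahiCombTriangleThinEdgeLattice

/-!
# The comb hierarchy for Sahi's `E_k`: the THIN-EDGE cells of the triangle class — `hybCoeff = TRI_W` on the lattice
# `2^{P} × 2^{Q}`, and (M⁺⁺-3) there from the five-up-set inequality

Support file of the one-cut programme (crux `NoHeavyLowerTail`, stmt-CriticalPhenomena-4575; cell `prim-masterthm`, seat P5 gen 8;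
report `P5-LORENTZIAN-TEST.md` §10.3, §11.1–11.3, §13).

By the class-T bridge (`SahiHybrid.hybCoeff_eq_tri`) the (M⁺⁺-3) coefficient of a class-T triple at the reduced profile `s` is
`TRI(f,g,h) = Σ_{x ⊆ A} Σ_{y ⊆ P} Σ_{z ⊆ Q} triTerm`, `A, P, Q` the three free blocks.  On a THIN EDGE (`A` has at most one element) this is the
tree's one-cube thin-edge functional `LatticeFiveUpSet.triWOne` (file `…SahiCombFiveUpSetTriW`) on the finite distributive lattice
`W = Set ↥P × Set ↥Q` with the antipode `τ = (compl, compl)`, for the five up-sets `H = famH`, `F₀ ⊆ F₁ = famF ∅ ⊆ famF A`,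
`G₀ ⊆ G₁ = famG ∅ ⊆ famG A` cut out by the sections:

* (bookkeeping in `…SahiCombTriangleThinEdgeLattice`: re-indexing by the points of `W`, signed counts `sum_tri_fixed_x`, the inequality on
  `Set β × Set γ` `fiveUpSetIneqOn_setProd`, up-set families;) here: `secH_eq_ite` etc. (sections = lattice indicators), **`sum_triTerm_fixed_x`**
  (the inner TRI sum for fixed `x` as signed counts of triple intersections, `τ`-images = reflected sections);
* **`SahiHybrid.hybCoeff_eq_triWOne`** (`A = {a}`): `hybCoeff E U s = triWOne τ H F₀ F₁ G₀ G₁`;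
  **`SahiHybrid.two_mul_hybCoeff_eq_triWOne`** (`A = ∅`): `2·hybCoeff E U s = triWOne τ H F₀ F₀ G₀ G₀`;
* **`SahiHybrid.hybCoeff_nonneg_of_thinEdge`** — for a class-T triple of increasing events with `#(E 0 ∩ E 1) ≤ 1`, GIVEN the one-cube
  five-up-set inequality `FiveUpSet.FiveUpSetIneq`, every (M⁺⁺-3) coefficient is `≥ 0`; hence (`combPos_thinEdge`) `p ↦ E_3(μ_p; 1_U)` is
  comb-positive at the minimal multidegree and (`sahiE_three_nonneg_thinEdge`) `E_3(μ_p; 1_{U_0}, 1_{U_1}, 1_{U_2}) ≥ 0` for EVERY product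
  measure `μ_p` — the triangle class with a thin edge: three ARBITRARY jointly-increasing events on pairwise-shared blocks, beyond every
  stratum proved so far (cylinders / read-once / hitting / domination).
`FiveUpSetIneq` is a typed conjecture of ours (gen 6); prim-lf-1 gen 17 has a proof (rank form (RANK-Z), memo `FROM-prim-lf-1-g17-FIVE-UPSET-PROOF.md`)
whose formalisation is in progress — until it lands the results here are CONDITIONAL on it (hypothesis `h5`), and become unconditional by
`fun … => thm FiveUpSetIneq_proof …` the moment it does.  Everything else is proved; axioms standard.
HONEST LABEL: conditional theorem (hypothesis = our own typed conjecture, announced proved); (M⁺⁺-3) in general and `C_3` stay OPEN. [this work]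
-/

noncomputable section

open scoped Classical

namespace Summit.CriticalPhenomena.PercolationContinuityZ3.Theorems

open Finset Function
open Literature.Combinatorics.Sahi2008
open Literature.Probability.Percolation (DeterminedBy determinedBy_iff)
open Literature.Probability.Percolation.DecisionTree (ind ind_of_mem ind_of_not_mem ind_nonneg)
open SahiComb LatticeFiveUpSet

namespace SahiHybrid

variable {ι : Type} [Fintype ι]

/-! ### The thin-edge lattice: sections as lattice indicators -/

section Lattice

variable {E : Fin 3 → Finset ι} {s : ι → ℕ} {U : Fin 3 → Set (Set ι)}

omit [Fintype ι] in
/-- The antipode of the thin-edge lattice `Set ↥P × Set ↥Q`: `(y, z) ↦ (yᶜ, zᶜ)`. [this work] -/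
theorem prodCongr_boolCompl_apply (P Q : Set ι) (w : Set ↥P × Set ↥Q) :
    (boolCompl (Set ↥P)).prodCongr (boolCompl (Set ↥Q)) w = (w.1ᶜ, w.2ᶜ) := rfl

/-- The section `h` is the indicator of `famH`. [this work] -/
theorem secH_eq_ite (P Q : Set ι) (w : Set ↥P × Set ↥Q) :
    secH E s U (Subtype.val '' w.1) (Subtype.val '' w.2)
      = if w ∈ famH (U 2) (frozenOpen E s 2) P Q then (1 : ℝ) else 0 := by
  unfold secH
  by_cases h : w ∈ famH (U 2) (frozenOpen E s 2) P Q
  · rw [if_pos h, ind_of_mem (mem_famH.1 h)]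
  · rw [if_neg h, ind_of_not_mem fun h' => h (mem_famH.2 h')]

/-- The section `f(x, ·)` is the indicator of `famF x`. [this work] -/
theorem secF_eq_ite (x : Set ι) (P Q : Set ι) (w : Set ↥P × Set ↥Q) :
    secF E s U x (Subtype.val '' w.1) = if w ∈ famF (U 0) (frozenOpen E s 0) x P Q then (1 : ℝ) else 0 := by
  unfold secF
  by_cases h : w ∈ famF (U 0) (frozenOpen E s 0) x P Q
  · rw [if_pos h, ind_of_mem (mem_famF.1 h)]
  · rw [if_neg h, ind_of_not_mem fun h' => h (mem_famF.2 h')]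

/-- The reflected section `f(x, P \ ·)` is the indicator of `famF x` at the antipode. [this work] -/
theorem secF_compl_eq_ite (x Q : Set ι) (w : Set ↥(freePair E s 0 2) × Set ↥Q) :
    secF E s U x (freePair E s 0 2 \ Subtype.val '' w.1)
      = if (boolCompl _).prodCongr (boolCompl (Set ↥Q)) w ∈ famF (U 0) (frozenOpen E s 0) x (freePair E s 0 2) Q
        then (1 : ℝ) else 0 := by
  unfold secF
  rw [← image_val_compl]
  by_cases h : (boolCompl _).prodCongr (boolCompl (Set ↥Q)) w ∈ famF (U 0) (frozenOpen E s 0) x (freePair E s 0 2) Q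
  · rw [if_pos h]
    rw [mem_famF, prodCongr_boolCompl_apply] at h
    exact ind_of_mem h
  · rw [if_neg h]
    refine ind_of_not_mem fun h' => h ?_
    rw [mem_famF, prodCongr_boolCompl_apply]
    exact h'

/-- The section `g(x, ·)` is the indicator of `famG x`. [this work] -/
theorem secG_eq_ite (x : Set ι) (P Q : Set ι) (w : Set ↥P × Set ↥Q) :
    secG E s U x (Subtype.val '' w.2) = if w ∈ famG (U 1) (frozenOpen E s 1) x P Q then (1 : ℝ) else 0 := by
  unfold secG
  by_cases h : w ∈ famG (U 1) (frozenOpen E s 1) x P Q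
  · rw [if_pos h, ind_of_mem (mem_famG.1 h)]
  · rw [if_neg h, ind_of_not_mem fun h' => h (mem_famG.2 h')]

/-- The reflected section `g(x, Q \ ·)` is the indicator of `famG x` at the antipode. [this work] -/
theorem secG_compl_eq_ite (x P : Set ι) (w : Set ↥P × Set ↥(freePair E s 1 2)) :
    secG E s U x (freePair E s 1 2 \ Subtype.val '' w.2)
      = if (boolCompl (Set ↥P)).prodCongr (boolCompl _) w ∈ famG (U 1) (frozenOpen E s 1) x P (freePair E s 1 2)
        then (1 : ℝ) else 0 := by
  unfold secG
  rw [← image_val_compl]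
  by_cases h : (boolCompl (Set ↥P)).prodCongr (boolCompl _) w ∈ famG (U 1) (frozenOpen E s 1) x P (freePair E s 1 2)
  · rw [if_pos h]
    rw [mem_famG, prodCongr_boolCompl_apply] at h
    exact ind_of_mem h
  · rw [if_neg h]
    refine ind_of_not_mem fun h' => h ?_
    rw [mem_famG, prodCongr_boolCompl_apply]
    exact h'

/-- **The inner TRI sum for fixed `x` on a class-T fibre is a signed count on the thin-edge lattice.**  With `P = freePair 0 2`,
`Q = freePair 1 2`, `τ = (compl, compl)`, `H = famH`, `F_x = famF x`, `G_x = famG x`, `x̄ = A \ x`: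
`Σ_{y ⊆ P} Σ_{z ⊆ Q} triTerm x y z = 2#(H∩F_x∩G_x) − #(H∩τF_x̄∩G_x) − #(H∩F_x̄∩τG_x) − #(H∩τF_x∩τG_x) + #(H∩τF_x̄∩τG_x)`. [this work] -/
theorem sum_triTerm_fixed_x (x : Set ι) :
    ∑ y ∈ univ.filter (fun y : Set ι => y ⊆ freePair E s 0 2), ∑ z ∈ univ.filter (fun z : Set ι => z ⊆ freePair E s 1 2),
        triTerm E s U x y z
      = 2 * ((famH (U 2) (frozenOpen E s 2) (freePair E s 0 2) (freePair E s 1 2)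
                ∩ famF (U 0) (frozenOpen E s 0) x (freePair E s 0 2) (freePair E s 1 2)
                ∩ famG (U 1) (frozenOpen E s 1) x (freePair E s 0 2) (freePair E s 1 2)).card : ℝ)
        - ((famH (U 2) (frozenOpen E s 2) (freePair E s 0 2) (freePair E s 1 2)
              ∩ (famF (U 0) (frozenOpen E s 0) (freePair E s 0 1 \ x) (freePair E s 0 2) (freePair E s 1 2)).image
                  ((boolCompl (Set ↥(freePair E s 0 2))).prodCongr (boolCompl (Set ↥(freePair E s 1 2))))
              ∩ famG (U 1) (frozenOpen E s 1) x (freePair E s 0 2) (freePair E s 1 2)).card : ℝ)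
        - ((famH (U 2) (frozenOpen E s 2) (freePair E s 0 2) (freePair E s 1 2)
              ∩ famF (U 0) (frozenOpen E s 0) (freePair E s 0 1 \ x) (freePair E s 0 2) (freePair E s 1 2)
              ∩ (famG (U 1) (frozenOpen E s 1) x (freePair E s 0 2) (freePair E s 1 2)).image
                  ((boolCompl (Set ↥(freePair E s 0 2))).prodCongr (boolCompl (Set ↥(freePair E s 1 2))))).card : ℝ)
        - ((famH (U 2) (frozenOpen E s 2) (freePair E s 0 2) (freePair E s 1 2)
              ∩ (famF (U 0) (frozenOpen E s 0) x (freePair E s 0 2) (freePair E s 1 2)).image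
                  ((boolCompl (Set ↥(freePair E s 0 2))).prodCongr (boolCompl (Set ↥(freePair E s 1 2))))
              ∩ (famG (U 1) (frozenOpen E s 1) x (freePair E s 0 2) (freePair E s 1 2)).image
                  ((boolCompl (Set ↥(freePair E s 0 2))).prodCongr (boolCompl (Set ↥(freePair E s 1 2))))).card : ℝ)
        + ((famH (U 2) (frozenOpen E s 2) (freePair E s 0 2) (freePair E s 1 2)
              ∩ (famF (U 0) (frozenOpen E s 0) (freePair E s 0 1 \ x) (freePair E s 0 2) (freePair E s 1 2)).image
                  ((boolCompl (Set ↥(freePair E s 0 2))).prodCongr (boolCompl (Set ↥(freePair E s 1 2))))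
              ∩ (famG (U 1) (frozenOpen E s 1) x (freePair E s 0 2) (freePair E s 1 2)).image
                  ((boolCompl (Set ↥(freePair E s 0 2))).prodCongr (boolCompl (Set ↥(freePair E s 1 2))))).card : ℝ) := by
  set P := freePair E s 0 2 with hP
  set Q := freePair E s 1 2 with hQ
  set τ := (boolCompl (Set ↥P)).prodCongr (boolCompl (Set ↥Q)) with hτdef
  set H := famH (U 2) (frozenOpen E s 2) P Q with hH
  set F := famF (U 0) (frozenOpen E s 0) x P Q with hF
  set F' := famF (U 0) (frozenOpen E s 0) (freePair E s 0 1 \ x) P Q with hF'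
  set G := famG (U 1) (frozenOpen E s 1) x P Q with hG
  rw [sum_subsets_prod]
  have hτ : ∀ w, τ (τ w) = w := fun w => by
    simp only [hτdef, prodCongr_boolCompl_apply, compl_compl]
  rw [← sum_tri_fixed_x τ hτ H F F' G]
  refine sum_congr rfl fun w _ => ?_
  unfold triTerm
  rw [secH_eq_ite, secF_eq_ite, secG_eq_ite, secF_compl_eq_ite, secF_compl_eq_ite, secF_eq_ite, secG_compl_eq_ite]

end Lattice

/-! ### `hybCoeff = TRI_W` on a thin edge -/

section Bridge

variable {E : Fin 3 → Finset ι} {s : ι → ℕ} (hT : IsClassT E) (U : Fin 3 → Set (Set ι)) (hU : ∀ i, DeterminedBy (U i) ↑(E i))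
  (hs : s ∈ box (minDeg E))

include hT hU hs

/-- **Thin edge with ONE free `x`-coordinate**: if the free block of the pair `{0,1}` is a singleton `{a}`, then with `P = freePair 0 2`,
`Q = freePair 1 2`, `τ = (compl, compl)`, `H = famH`, `F₀ = famF ∅ ⊆ F₁ = famF {a}`, `G₀ = famG ∅ ⊆ G₁ = famG {a}`:
`hybCoeff E U s = triWOne τ H F₀ F₁ G₀ G₁` — the tree's thin-edge triangle functional (`…SahiCombFiveUpSetTriW`) on `Set ↥P × Set ↥Q`. [this work] -/
theorem hybCoeff_eq_triWOne {a : ι} (hA : freePair E s 0 1 = {a}) :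
    hybCoeff E U s = (triWOne ((boolCompl (Set ↥(freePair E s 0 2))).prodCongr (boolCompl (Set ↥(freePair E s 1 2))))
      (famH (U 2) (frozenOpen E s 2) (freePair E s 0 2) (freePair E s 1 2))
      (famF (U 0) (frozenOpen E s 0) ∅ (freePair E s 0 2) (freePair E s 1 2))
      (famF (U 0) (frozenOpen E s 0) {a} (freePair E s 0 2) (freePair E s 1 2))
      (famG (U 1) (frozenOpen E s 1) ∅ (freePair E s 0 2) (freePair E s 1 2))
      (famG (U 1) (frozenOpen E s 1) {a} (freePair E s 0 2) (freePair E s 1 2)) : ℝ) := by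
  rw [hybCoeff_eq_tri hT U hU hs]
  -- the `x`-sum has the two terms `x = ∅` (with `x̄ = {a}`) and `x = {a}` (with `x̄ = ∅`)
  have hX : (univ.filter fun x : Set ι => x ⊆ freePair E s 0 1) = {∅, {a}} := by
    ext x
    rw [mem_filter, hA, Set.subset_singleton_iff_eq, mem_insert, mem_singleton]
    simp
  rw [hX, sum_pair (by simp : (∅ : Set ι) ≠ {a})]
  have h0 := sum_triTerm_fixed_x (E := E) (s := s) (U := U) (∅ : Set ι)
  have h1 := sum_triTerm_fixed_x (E := E) (s := s) (U := U) ({a} : Set ι)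
  rw [hA, Set.sdiff_empty] at h0
  rw [hA, sdiff_self, Set.bot_eq_empty] at h1
  rw [h0, h1]
  unfold triWOne
  push_cast
  ring

/-- **Thin edge with NO free `x`-coordinate**: if the free block of the pair `{0,1}` is empty, then with `F₀ = famF ∅`, `G₀ = famG ∅`:
`2·hybCoeff E U s = triWOne τ H F₀ F₀ G₀ G₀`. [this work] -/
theorem two_mul_hybCoeff_eq_triWOne (hA : freePair E s 0 1 = ∅) :
    2 * hybCoeff E U s = (triWOne ((boolCompl (Set ↥(freePair E s 0 2))).prodCongr (boolCompl (Set ↥(freePair E s 1 2))))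
      (famH (U 2) (frozenOpen E s 2) (freePair E s 0 2) (freePair E s 1 2))
      (famF (U 0) (frozenOpen E s 0) ∅ (freePair E s 0 2) (freePair E s 1 2))
      (famF (U 0) (frozenOpen E s 0) ∅ (freePair E s 0 2) (freePair E s 1 2))
      (famG (U 1) (frozenOpen E s 1) ∅ (freePair E s 0 2) (freePair E s 1 2))
      (famG (U 1) (frozenOpen E s 1) ∅ (freePair E s 0 2) (freePair E s 1 2)) : ℝ) := by
  rw [hybCoeff_eq_tri hT U hU hs]
  have hX : (univ.filter fun x : Set ι => x ⊆ freePair E s 0 1) = {∅} := by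
    ext x
    rw [mem_filter, hA, Set.subset_empty_iff, mem_singleton]
    simp
  rw [hX, sum_singleton]
  have h0 := sum_triTerm_fixed_x (E := E) (s := s) (U := U) (∅ : Set ι)
  rw [hA, Set.sdiff_empty] at h0
  rw [h0]
  unfold triWOne
  push_cast
  ring

end Bridge

/-! ### (M⁺⁺-3) on the thin-edge cells of the triangle class, from the five-up-set inequality -/

omit [Fintype ι] in
/-- The free block of the pair `{0,1}` lies in `E 0 ∩ E 1`; on a thin edge it is empty or a singleton. [this work] -/
theorem freePair01_eq_empty_or_singleton {E : Fin 3 → Finset ι} (hthin : (E 0 ∩ E 1).card ≤ 1) (s : ι → ℕ) :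
    freePair E s 0 1 = ∅ ∨ ∃ a, freePair E s 0 1 = {a} := by
  refine Set.Subsingleton.eq_empty_or_singleton fun a ha b hb => ?_
  have ha' : a ∈ E 0 ∩ E 1 := mem_inter.2 ⟨ha.1, ha.2.1⟩
  have hb' : b ∈ E 0 ∩ E 1 := mem_inter.2 ⟨hb.1, hb.2.1⟩
  exact Finset.card_le_one.1 hthin a ha' b hb'

/-- **(M⁺⁺-3) on the thin-edge cells of the triangle class, from the five-up-set inequality.**  For three increasing events `U_i`
determined by declared supports `E_i` with no coordinate declared thrice (class T) and `#(E 0 ∩ E 1) ≤ 1` (thin edge), GIVEN the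
one-cube five-up-set inequality, every minimal-multidegree tensor-Bernstein coefficient `hybCoeff E U s` is `≥ 0`.  Proof: outside the box
the coefficient vanishes; inside, `hybCoeff` (or twice it) is `triWOne` on `Set ↥P × Set ↥Q` (`hybCoeff_eq_triWOne`,
`two_mul_hybCoeff_eq_triWOne`), which is `≥ 0` by `triWOne_nonneg_of_on` and `fiveUpSetIneqOn_setProd`. [this work] -/
theorem hybCoeff_nonneg_of_thinEdge (h5 : FiveUpSet.FiveUpSetIneq) {E : Fin 3 → Finset ι} (hT : IsClassT E)
    (hthin : (E 0 ∩ E 1).card ≤ 1) (U : Fin 3 → Set (Set ι)) (hU : ∀ i, DeterminedBy (U i) ↑(E i))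
    (hmono : ∀ i, IsUpperSet (U i)) (s : ι → ℕ) : 0 ≤ hybCoeff E U s := by
  by_cases hs : s ∈ box (minDeg E)
  swap
  · rw [hybCoeff_eq_zero_of_not_mem_box E U hs]
  have hτ : ∀ a b : Set ↥(freePair E s 0 2) × Set ↥(freePair E s 1 2),
      (boolCompl (Set ↥(freePair E s 0 2))).prodCongr (boolCompl (Set ↥(freePair E s 1 2))) a ≤
        (boolCompl (Set ↥(freePair E s 0 2))).prodCongr (boolCompl (Set ↥(freePair E s 1 2))) b ↔ b ≤ a := by
    intro a b
    simp only [prodCongr_boolCompl_apply, Prod.le_def, Set.compl_subset_compl]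
  have hW := fiveUpSetIneqOn_setProd h5 ↥(freePair E s 0 2) ↥(freePair E s 1 2)
  have hH := isUpperSet_famH (P := freePair E s 0 2) (Q := freePair E s 1 2) (hmono 2) (frozenOpen E s 2)
  rcases freePair01_eq_empty_or_singleton hthin s with hA | ⟨a, hA⟩
  · have h2 := two_mul_hybCoeff_eq_triWOne hT U hU hs hA
    have hnn := triWOne_nonneg_of_on (Set ↥(freePair E s 0 2) × Set ↥(freePair E s 1 2)) _ hτ hW
      (famH (U 2) (frozenOpen E s 2) (freePair E s 0 2) (freePair E s 1 2))
      (famF (U 0) (frozenOpen E s 0) ∅ (freePair E s 0 2) (freePair E s 1 2))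
      (famF (U 0) (frozenOpen E s 0) ∅ (freePair E s 0 2) (freePair E s 1 2))
      (famG (U 1) (frozenOpen E s 1) ∅ (freePair E s 0 2) (freePair E s 1 2))
      (famG (U 1) (frozenOpen E s 1) ∅ (freePair E s 0 2) (freePair E s 1 2)) hH
      (isUpperSet_famF (hmono 0) _ _) (isUpperSet_famF (hmono 0) _ _) (isUpperSet_famG (hmono 1) _ _)
      (isUpperSet_famG (hmono 1) _ _) (Subset.refl _) (Subset.refl _)
    have : (0 : ℝ) ≤ 2 * hybCoeff E U s := by rw [h2]; exact_mod_cast hnn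
    linarith
  · have h1 := hybCoeff_eq_triWOne hT U hU hs hA
    have hnn := triWOne_nonneg_of_on (Set ↥(freePair E s 0 2) × Set ↥(freePair E s 1 2)) _ hτ hW
      (famH (U 2) (frozenOpen E s 2) (freePair E s 0 2) (freePair E s 1 2))
      (famF (U 0) (frozenOpen E s 0) ∅ (freePair E s 0 2) (freePair E s 1 2))
      (famF (U 0) (frozenOpen E s 0) {a} (freePair E s 0 2) (freePair E s 1 2))
      (famG (U 1) (frozenOpen E s 1) ∅ (freePair E s 0 2) (freePair E s 1 2))
      (famG (U 1) (frozenOpen E s 1) {a} (freePair E s 0 2) (freePair E s 1 2)) hH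
      (isUpperSet_famF (hmono 0) _ _) (isUpperSet_famF (hmono 0) _ _) (isUpperSet_famG (hmono 1) _ _)
      (isUpperSet_famG (hmono 1) _ _) (famF_mono (hmono 0) _ (Set.empty_subset _)) (famG_mono (hmono 1) _ (Set.empty_subset _))
    rw [h1]; exact_mod_cast hnn

/-- The pivotal supports of three increasing events form a class-T declared-support system iff no coordinate is pivotal for all three;
with them, **comb positivity at the minimal multidegree** (the row (M⁺⁺-3)) holds for every thin-edge class-T triple, given the five-up-set
inequality. [this work] -/
theorem combPos_thinEdge (h5 : FiveUpSet.FiveUpSetIneq) (U : Fin 3 → Set (Set ι)) (hmono : ∀ i, IsUpperSet (U i))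
    (hT : IsClassT fun i => esupp (U i)) (hthin : (esupp (U 0) ∩ esupp (U 1)).card ≤ 1) :
    CombPos (minDeg fun i => esupp (U i)) (fun p => sahiE (bernoulliWeight p) 3 (fun i => ind (U i))) :=
  combPos_of_hybCoeff_nonneg U (fun i => esupp (U i)) (fun i => determinedBy_esupp (hmono i))
    (hybCoeff_nonneg_of_thinEdge h5 hT hthin U (fun i => determinedBy_esupp (hmono i)) hmono)

/-- **Sahi positivity `E_3 ≥ 0` for every product measure on the thin-edge cells of the triangle class**, given the five-up-set inequality:
three increasing events, no coordinate pivotal for all three, at most one coordinate pivotal for both `U_0` and `U_1`. [this work] -/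
theorem sahiE_three_nonneg_thinEdge (h5 : FiveUpSet.FiveUpSetIneq) (U : Fin 3 → Set (Set ι)) (hmono : ∀ i, IsUpperSet (U i))
    (hT : IsClassT fun i => esupp (U i)) (hthin : (esupp (U 0) ∩ esupp (U 1)).card ≤ 1) (p : ι → unitInterval) :
    0 ≤ sahiE (bernoulliWeight p) 3 (fun i => ind (U i)) :=
  (combPos_thinEdge h5 U hmono hT hthin).nonneg p

end SahiHybrid

end Summit.CriticalPhenomena.PercolationContinuityZ3.Theorems
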